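import Summits.Ventures.PercRepro.RankLevelSetRuleQSliceSecondUntruncLarge
import Summits.Ventures.PercRepro.RankLevelSetRuleQSliceThreeChain
import Summits.Ventures.PercRepro.RankLevelSetRuleQSliceTwoChain
import Summits.Ventures.PercRepro.RankLevelSetRuleQCellOne

/-!
# PercRepro — THE THIRD UNTRUNCATED SLICE `u = k + 1` ON EVERY CELL OF EVERY FAMILY `k ≥ 5` (night-1, gen 22; dossier §33.6)

The slice `u = k + 1` (`q = m + k + 1`), cell by cell, in the pattern of gen 21 (bottom) and of this gen (the climb):
* `m = 0, 1`: `rhat_zero_eq`, `rhatCell_one`;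
* `m = 2` (`q = k + 3`): the `m = 2` chain of every slice with `P₂(k+1, k) = 1/2` gives `T_{k+1}(2) ≤ 45/28`
  (`sliceTail_kp1_two_le`), against the slack `1 + ρ(3k+6, k+3) − ρ(k+5, 2) ≥ 1 + 7/4 − 8/7 = 45/28` (`rho_third_two_ge`,
  `rho_kp5_two_le`) — `third_untrunc_two`;
* `3 ≤ m ≤ k² − 1` (the bottom regime): the criterion `slice_bottom_of_three_le_one` with `T_{k+1}(3) ≤ 1` — for `k ≥ 17` by the
  `m = 3` chain with `P₀(k+1, k) = 1/2` and the exact first term (a sextic in `k`, all coefficients positive from `k = 17`: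
  `sliceTail_kp1_three_le_one_of_large`), for `11 ≤ k ≤ 16` by exact evaluation (`_of_small`) — `third_untrunc_bottom`;
* `m ≥ k²` (the large-q half): one slice step up from `second_untrunc_slice_every` at fixed `q` (`phiK_le_rhat_of_sliceStep`),
  the monotone step `C(2k, k−1)·S_k ≤ S_1` from the moment bounds (`k·(2J_2) ≤ 17/18`, `18·C(2k, k) ≤ C(k²+d+1, d)` by the
  two-step induction `tK3`) — `third_untrunc_large`;
* **`third_untrunc_slice_every (k q) (5 ≤ k) (k + 1 ≤ q) : Φ(q+k, q) ≤ R̂(q, k, q − (k + 1))`** (`k ≤ 10` by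
  `rhat_slice_iff_all_ten`); **`ruleQRecv_ge_phiK_third_untrunc_every`** — the matroid level.
Axioms: standard.
-/

namespace PercRepro

open Finset

/-! ### §1 The cell `m = 3`: `T_{k+1}(3) ≤ 1` -/

/-- `P₀(k+1, k) = 1/2`. -/
lemma threeRatio_kp1 (k : ℕ) : threeRatio (k + 1) k = 1 / 2 := by
  unfold threeRatio
  push_cast
  field_simp
  ring

/-- **`T_{k+1}(3) ≤ 1` for `k ≥ 17`**: the chain `T ≤ 2·term₀` with the exact first term. -/
lemma sliceTail_kp1_three_le_one_of_large (k : ℕ) (hk : 17 ≤ k) : sliceTail (k + 1) k 3 ≤ 1 := by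
  have hP : threeRatio (k + 1) k < 1 := by rw [threeRatio_kp1]; norm_num
  have h := sliceTail_three_le_chain (k + 1) k hP
  rw [threeRatio_kp1, sliceThreeTerm_zero_eq] at h
  refine h.trans ?_
  obtain ⟨n, rfl⟩ : ∃ n, k = n + 17 := ⟨k - 17, by omega⟩
  push_cast
  have hn : (0 : ℚ) ≤ n := by positivity
  rw [show (1 : ℚ) / (1 - 1 / 2) = 2 by norm_num]
  have h1 : (0 : ℚ) < ((n : ℚ) + 17 + 1 + (n + 17) + 1) := by positivity
  rw [div_mul_eq_mul_div, div_mul_eq_mul_div, div_le_one (by positivity)]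
  field_simp
  nlinarith [pow_nonneg hn 2, pow_nonneg hn 3, pow_nonneg hn 4, pow_nonneg hn 5, pow_nonneg hn 6,
    mul_nonneg hn (pow_nonneg hn 2), mul_nonneg hn (pow_nonneg hn 3), mul_nonneg hn (pow_nonneg hn 4),
    mul_nonneg hn (pow_nonneg hn 5)]

/-- **`T_{k+1}(3) ≤ 1` for `11 ≤ k ≤ 16`** by exact evaluation. -/
lemma sliceTail_kp1_three_le_one_of_small (k : ℕ) (h11 : 11 ≤ k) (h16 : k ≤ 16) : sliceTail (k + 1) k 3 ≤ 1 := by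
  rw [sliceTail_three_eq]
  interval_cases k <;>
    (simp only [Finset.sum_range_succ, Finset.sum_range_zero, sliceThreeTerm, Nat.choose_eq_descFactorial_div_factorial]
     norm_num [Nat.descFactorial, Nat.factorial])

/-- **`T_{k+1}(3) ≤ 1` for every `k ≥ 11`.** -/
theorem sliceTail_kp1_three_le_one (k : ℕ) (hk : 11 ≤ k) : sliceTail (k + 1) k 3 ≤ 1 := by
  rcases Nat.lt_or_ge k 17 with h | h
  · exact sliceTail_kp1_three_le_one_of_small k hk (by omega)
  · exact sliceTail_kp1_three_le_one_of_large k h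

/-- **THE BOTTOM REGIME OF `u = k + 1`**: `3 ≤ m ≤ k² − 1` ⇒ `Φ(q+k, q) ≤ R̂(q, k, m)` (`q = m + k + 1`, `k ≥ 11`). -/
theorem third_untrunc_bottom (k m : ℕ) (hk : 11 ≤ k) (h3 : 3 ≤ m) (hm : m + 1 ≤ k * k) :
    phiK (m + (k + 1) + k) (m + (k + 1)) ≤ rhat (m + (k + 1)) k m :=
  slice_bottom_of_three_le_one (k + 1) k m (by omega) (by nlinarith) h3 (by nlinarith)
    (sliceTail_kp1_three_le_one k hk)

/-! ### §2 The cell `m = 2` -/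

/-- `P₂(k+1, k) = 1/2`. -/
lemma twoRatio_kp1 (k : ℕ) : twoRatio (k + 1) k = 1 / 2 := by
  unfold twoRatio
  push_cast
  field_simp
  ring

/-- **`T_{k+1}(2) ≤ 45/28` for `k ≥ 6`** (the chain with the bracket `≤ 9/4`). -/
lemma sliceTail_kp1_two_le (k : ℕ) (hk : 6 ≤ k) : sliceTail (k + 1) k 2 ≤ 45 / 28 := by
  have hk' : (6 : ℚ) ≤ k := by exact_mod_cast hk
  have hP : twoRatio (k + 1) k < 1 := by rw [twoRatio_kp1]; norm_num
  have h := sliceTail_two_le_chain (k + 1) k hP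
  rw [twoRatio_kp1, sliceTwoTerm_zero_eq] at h
  push_cast at h
  have x1 : ((k : ℚ) + 1) / ((k : ℚ) + 1 + k + 3) ≤ 1 / 2 := by
    rw [div_le_div_iff₀ (by positivity) (by norm_num)]; linarith
  have x2 : ((k : ℚ) + 2) / ((k : ℚ) + 1 + k + 4) ≤ 1 / 2 := by
    rw [div_le_div_iff₀ (by positivity) (by norm_num)]; linarith
  have x10 : 0 ≤ ((k : ℚ) + 1) / ((k : ℚ) + 1 + k + 3) := by positivity
  have x20 : 0 ≤ ((k : ℚ) + 2) / ((k : ℚ) + 1 + k + 4) := by positivity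
  have hbr : 1 + 2 * (((k : ℚ) + 1) / ((k : ℚ) + 1 + k + 3))
      + ((k : ℚ) + 1) / ((k : ℚ) + 1 + k + 3) * (((k : ℚ) + 2) / ((k : ℚ) + 1 + k + 4)) ≤ 9 / 4 := by
    nlinarith [mul_le_mul x1 x2 x20 (by norm_num)]
  have hpre : (0 : ℚ) ≤ ((k : ℚ) + 1 + 1) * ((k : ℚ) + 1 + 2) / (((k : ℚ) + 1 + k + 1) * ((k : ℚ) + 1 + k + 2)) := by
    positivity
  have hpre2 : ((k : ℚ) + 1 + 1) * ((k : ℚ) + 1 + 2) / (((k : ℚ) + 1 + k + 1) * ((k : ℚ) + 1 + k + 2)) * (9 / 4)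
      * (1 / (1 - 1 / 2)) ≤ 45 / 28 := by
    rw [show (1 : ℚ) / (1 - 1 / 2) = 2 by norm_num, div_mul_eq_mul_div, div_mul_eq_mul_div,
      div_le_div_iff₀ (by positivity) (by norm_num)]
    nlinarith
  calc sliceTail (k + 1) k 2
      ≤ ((k : ℚ) + 1 + 1) * ((k : ℚ) + 1 + 2) / (((k : ℚ) + 1 + k + 1) * ((k : ℚ) + 1 + k + 2))
          * (1 + 2 * (((k : ℚ) + 1) / ((k : ℚ) + 1 + k + 3))
            + ((k : ℚ) + 1) / ((k : ℚ) + 1 + k + 3) * (((k : ℚ) + 2) / ((k : ℚ) + 1 + k + 4))) * (1 / (1 - 1 / 2)) := h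
    _ ≤ ((k : ℚ) + 1 + 1) * ((k : ℚ) + 1 + 2) / (((k : ℚ) + 1 + k + 1) * ((k : ℚ) + 1 + k + 2)) * (9 / 4)
          * (1 / (1 - 1 / 2)) := by gcongr
    _ ≤ 45 / 28 := hpre2

/-- **`ρ(3k+6, k+3) ≥ 7/4`** (`k ≥ 4`), in the spelling of `phiK_le_rhat_of_sliceTail` at `m = 2`, `u = k + 1`. -/
lemma rho_third_two_ge (k : ℕ) (hk : 4 ≤ k) :
    (7 : ℚ) / 4 ≤ (∑ i ∈ range (2 + (k + 1) + 1), ((2 * (2 + (k + 1)) + k).choose i : ℚ))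
      / ((2 * (2 + (k + 1)) + k).choose (2 + (k + 1)) : ℚ) := by
  rw [rho_as_prod_sum (2 * (2 + (k + 1)) + k) (2 + (k + 1)) (by omega)]
  have hsub : ∑ s ∈ range 5, ∏ t ∈ range s,
        ((((2 + (k + 1) : ℕ) : ℚ) - t) / (((2 * (2 + (k + 1)) + k : ℕ) : ℚ) - ((2 + (k + 1) : ℕ) : ℚ) + 1 + t))
      ≤ ∑ s ∈ range (2 + (k + 1) + 1), ∏ t ∈ range s,
        ((((2 + (k + 1) : ℕ) : ℚ) - t) / (((2 * (2 + (k + 1)) + k : ℕ) : ℚ) - ((2 + (k + 1) : ℕ) : ℚ) + 1 + t)) := by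
    apply Finset.sum_le_sum_of_subset_of_nonneg (Finset.range_mono (by omega))
    intro s hs _
    rw [Finset.mem_range] at hs
    apply Finset.prod_nonneg
    intro t ht
    rw [Finset.mem_range] at ht
    have ht0 : (0 : ℚ) ≤ t := by positivity
    apply div_nonneg
    · push_cast
      have : (t : ℚ) ≤ 2 + ((k : ℚ) + 1) := by exact_mod_cast (by omega : t ≤ 2 + (k + 1))
      linarith
    · push_cast; linarith
  refine le_trans ?_ hsub
  simp only [Finset.sum_range_succ, Finset.sum_range_zero, Finset.prod_range_succ, Finset.prod_range_zero]
  push_cast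
  have hk' : (4 : ℚ) ≤ k := by exact_mod_cast hk
  have f1 : (1 : ℚ) / 2 ≤ (2 + ((k : ℚ) + 1) - 0) / (2 * (2 + ((k : ℚ) + 1)) + k - (2 + ((k : ℚ) + 1)) + 1 + 0) := by
    rw [div_le_div_iff₀ (by norm_num) (by linarith)]; linarith
  have f2 : (3 : ℚ) / 7 ≤ (2 + ((k : ℚ) + 1) - 1) / (2 * (2 + ((k : ℚ) + 1)) + k - (2 + ((k : ℚ) + 1)) + 1 + 1) := by
    rw [div_le_div_iff₀ (by norm_num) (by linarith)]; linarith
  have f3 : (1 : ℚ) / 3 ≤ (2 + ((k : ℚ) + 1) - 2) / (2 * (2 + ((k : ℚ) + 1)) + k - (2 + ((k : ℚ) + 1)) + 1 + 2) := by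
    rw [div_le_div_iff₀ (by norm_num) (by linarith)]; linarith
  have f4 : (1 : ℚ) / 4 ≤ (2 + ((k : ℚ) + 1) - 3) / (2 * (2 + ((k : ℚ) + 1)) + k - (2 + ((k : ℚ) + 1)) + 1 + 3) := by
    rw [div_le_div_iff₀ (by norm_num) (by linarith)]; linarith
  have g1 : (0 : ℚ) ≤ (2 + ((k : ℚ) + 1) - 0) / (2 * (2 + ((k : ℚ) + 1)) + k - (2 + ((k : ℚ) + 1)) + 1 + 0) := by
    apply div_nonneg <;> linarith
  have g2 : (0 : ℚ) ≤ (2 + ((k : ℚ) + 1) - 1) / (2 * (2 + ((k : ℚ) + 1)) + k - (2 + ((k : ℚ) + 1)) + 1 + 1) := by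
    apply div_nonneg <;> linarith
  have g3 : (0 : ℚ) ≤ (2 + ((k : ℚ) + 1) - 2) / (2 * (2 + ((k : ℚ) + 1)) + k - (2 + ((k : ℚ) + 1)) + 1 + 2) := by
    apply div_nonneg <;> linarith
  have h12 := mul_le_mul f1 f2 (by norm_num) g1
  have h123 := mul_le_mul h12 f3 (by norm_num) (mul_nonneg g1 g2)
  have h1234 := mul_le_mul h123 f4 (by norm_num) (mul_nonneg (mul_nonneg g1 g2) g3)
  nlinarith [h12, h123, h1234]

/-- **`ρ(k+5, 2) ≤ 8/7`** for `k ≥ 11`: `ρ(k+5, 2) = 1 + 2(k+6)/((k+4)(k+5))`. -/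
lemma rho_kp5_two_le (k : ℕ) (hk : 11 ≤ k) :
    (∑ i ∈ range (2 + 1), ((2 * 2 + (k + 1)).choose i : ℚ)) / ((2 * 2 + (k + 1)).choose 2 : ℚ) ≤ 8 / 7 := by
  simp only [Finset.sum_range_succ, Finset.sum_range_zero, Nat.choose_zero_right, Nat.choose_one_right,
    Nat.cast_one, zero_add]
  rw [Nat.cast_choose_two]
  push_cast
  have hk' : (11 : ℚ) ≤ k := by exact_mod_cast hk
  rw [div_le_div_iff₀ (by nlinarith) (by norm_num)]
  nlinarith

/-- **The cell `m = 2` of `u = k + 1`** (`q = k + 3`, `k ≥ 11`): `Φ(2k+4, k+3) ≤ R̂(k+3, k, 2)`. -/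
theorem third_untrunc_two (k : ℕ) (hk : 11 ≤ k) :
    phiK (2 + (k + 1) + k) (2 + (k + 1)) ≤ rhat (2 + (k + 1)) k 2 := by
  apply phiK_le_rhat_of_sliceTail (k + 1) k 2 (by omega)
  have h1 := sliceTail_kp1_two_le k (by omega)
  have h2 := rho_third_two_ge k (by omega)
  have h3 := rho_kp5_two_le k hk
  linarith

/-! ### §3 The large-q half: one step up from `u = k` -/

/-- **The `k`-recursion `tK3`**: `18·C(2k, k) ≤ C(k² + d + 1, d)`, `d = ⌊(k−1)/2⌋`, for `k ≥ 11`. -/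
lemma tK3 (k : ℕ) (hk : 11 ≤ k) :
    18 * (2 * k).choose k ≤ (k * k + (k - 1) / 2 + 1).choose ((k - 1) / 2) := by
  obtain ⟨n, rfl⟩ : ∃ n, k = 11 + n := ⟨k - 11, by omega⟩
  clear hk
  induction n using Nat.twoStepInduction with
  | zero =>
    rw [show Nat.choose (2 * (11 + 0)) (11 + 0) = 705432 by decide,
      show (11 + 0 - 1) / 2 = 5 from rfl, show (11 + 0) * (11 + 0) + 5 + 1 = 127 from rfl,
      show Nat.choose 127 5 = 254231775 by
        rw [Nat.choose_eq_descFactorial_div_factorial]; norm_num [Nat.descFactorial, Nat.factorial]]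
    norm_num
  | one =>
    rw [show Nat.choose (2 * (11 + 1)) (11 + 1) = 2704156 by decide,
      show (11 + 1 - 1) / 2 = 5 from rfl, show (11 + 1) * (11 + 1) + 5 + 1 = 150 from rfl,
      show Nat.choose 150 5 = 591600030 by
        rw [Nat.choose_eq_descFactorial_div_factorial]; norm_num [Nat.descFactorial, Nat.factorial]]
    norm_num
  | more n ih _ =>
    set k := 11 + n with hkdef
    rw [show 11 + (n + 2) = k + 2 by omega]
    set d := (k - 1) / 2 with hd
    have hd5 : 5 ≤ d := by omega
    have hd2 : (k + 2 - 1) / 2 = d + 1 := by omega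
    rw [hd2]
    have hA : (2 * (k + 2)).choose (k + 2) ≤ 16 * (2 * k).choose k := by
      have e1 := choose_two_mul_succ_le k
      have e2 := choose_two_mul_succ_le (k + 1)
      rw [show k + 1 + 1 = k + 2 by ring] at e2
      omega
    have hB : (2 * n + 20) * (k * k + d + 1).choose d ≤ ((k + 2) * (k + 2) + (d + 1) + 1).choose (d + 1) := by
      have e1 := Nat.add_one_mul_choose_eq (k * k + d + 1) d
      have e2 : (k * k + d + 1 + 1).choose (d + 1) ≤ ((k + 2) * (k + 2) + (d + 1) + 1).choose (d + 1) :=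
        Nat.choose_le_choose (d + 1) (by nlinarith)
      have h2d : 2 * d + 1 ≤ k := by omega
      have h2d' : k ≤ 2 * d + 2 := by omega
      have hkk := Nat.mul_le_mul_left k h2d
      have e3 : (2 * n + 20) * (d + 1) ≤ k * k + d + 1 + 1 := by nlinarith [h2d, h2d', hkk, hkdef]
      calc (2 * n + 20) * (k * k + d + 1).choose d
          ≤ (k * k + d + 1 + 1) * (k * k + d + 1).choose d / (d + 1) := by
            rw [Nat.le_div_iff_mul_le (by omega)]
            nlinarith
        _ = (k * k + d + 1 + 1).choose (d + 1) := by
            rw [e1, Nat.mul_div_cancel _ (by omega)]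
        _ ≤ _ := e2
    calc 18 * (2 * (k + 2)).choose (k + 2)
        ≤ 18 * (16 * (2 * k).choose k) := Nat.mul_le_mul_left _ hA
      _ = 16 * (18 * (2 * k).choose k) := by ring
      _ ≤ 16 * (k * k + d + 1).choose d := Nat.mul_le_mul_left _ ih
      _ ≤ (2 * n + 20) * (k * k + d + 1).choose d := Nat.mul_le_mul_right _ (by omega)
      _ ≤ _ := hB

/-- **The monotone step for the third untruncated slice** (`q = m + 1 + k`, `k ≥ 11`, `m ≥ k²`):
`C(2k, k−1)·S_k(q, m) ≤ S_1(q, m)`. -/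
lemma step_third (k m : ℕ) (hk : 11 ≤ k) (hm : k * k ≤ m) :
    ((k + k).choose (k - 1) : ℚ) * sliceS (m + 1 + k) m k ≤ sliceS (m + 1 + k) m 1 := by
  set d := (k - 1) / 2 with hd
  have hd5 : 5 ≤ d := by omega
  have hlow := sliceS_one_ge m k
  have hup := sliceS_le_odd m k d (show m + 1 ≤ m + 1 + k by omega) (by omega)
  have hρ := diag_two_sq_le m
  have hρ0 : (0 : ℚ) ≤ 2 * sliceS (m + 1) m 2 := by
    have := sliceS_nonneg (m + 1) m 2; positivity
  have hmK : (k : ℚ) ^ 2 ≤ m := by exact_mod_cast (by nlinarith : k ^ 2 ≤ m)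
  have h1 : (k : ℚ) * (2 * sliceS (m + 1) m 2) ≤ 17 / 18 := by
    have hsq : ((k : ℚ) * (2 * sliceS (m + 1) m 2)) ^ 2 ≤ (17 / 18) ^ 2 := by
      calc ((k : ℚ) * (2 * sliceS (m + 1) m 2)) ^ 2 = (k : ℚ) ^ 2 * (2 * sliceS (m + 1) m 2) ^ 2 := by ring
        _ ≤ (k : ℚ) ^ 2 * (8 / (9 * ((m : ℚ) + 2))) := by gcongr
        _ ≤ (17 / 18) ^ 2 := by
            rw [show (k : ℚ) ^ 2 * (8 / (9 * ((m : ℚ) + 2))) = 8 * (k : ℚ) ^ 2 / (9 * ((m : ℚ) + 2)) by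
              field_simp, div_le_iff₀ (by positivity)]
            nlinarith
    nlinarith [hsq, hρ0]
  have hT := tK3 k hk
  rw [← hd] at hT
  have hCle : (k + k).choose (k - 1) ≤ (2 * k).choose k := by
    rw [show k + k = 2 * k by ring]
    have := Nat.choose_le_middle (k - 1) (2 * k)
    rwa [show 2 * k / 2 = k by omega] at this
  have hmono : ((k * k + d + 1).choose d : ℚ) ≤ ((m + d + 1).choose d : ℚ) := by
    exact_mod_cast Nat.choose_le_choose d (by omega)
  have hTq : (18 : ℚ) * ((k + k).choose (k - 1) : ℚ) ≤ ((m + d + 1).choose d : ℚ) := by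
    have e : (18 : ℚ) * ((k + k).choose (k - 1) : ℚ) ≤ ((k * k + d + 1).choose d : ℚ) := by
      have : 18 * (k + k).choose (k - 1) ≤ (k * k + d + 1).choose d :=
        (Nat.mul_le_mul_left 18 hCle).trans hT
      exact_mod_cast this
    exact e.trans hmono
  have hB : (0 : ℚ) < ((m + d + 1).choose d : ℚ) := Nat.cast_pos.mpr (Nat.choose_pos (by omega))
  have h2 : ((k + k).choose (k - 1) : ℚ) / ((m + d + 1).choose d : ℚ) ≤ 1 / 18 := by
    rw [div_le_iff₀ hB]; linarith
  calc ((k + k).choose (k - 1) : ℚ) * sliceS (m + 1 + k) m k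
      ≤ ((k + k).choose (k - 1) : ℚ)
          * (((m + 1 + k : ℕ) : ℚ) / ((m : ℚ) + 1) * (1 / (2 * ((m + d + 1).choose d : ℚ)))) :=
        mul_le_mul_of_nonneg_left hup (by positivity)
    _ = ((k + k).choose (k - 1) : ℚ) / ((m + d + 1).choose d : ℚ)
          * (((m + 1 + k : ℕ) : ℚ) / (2 * ((m : ℚ) + 1))) := by
        field_simp
    _ ≤ 1 / 18 * (((m + 1 + k : ℕ) : ℚ) / (2 * ((m : ℚ) + 1))) :=
        mul_le_mul_of_nonneg_right h2 (by positivity)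
    _ ≤ ((m + 1 + k : ℕ) : ℚ) / (2 * ((m : ℚ) + 1)) * (1 - (k : ℚ) * (2 * sliceS (m + 1) m 2)) := by
        have hy0 : (0 : ℚ) ≤ ((m + 1 + k : ℕ) : ℚ) / (2 * ((m : ℚ) + 1)) := by positivity
        have := mul_le_mul_of_nonneg_left h1 hy0
        nlinarith [this, hy0]
    _ ≤ sliceS (m + 1 + k) m 1 := hlow

/-- **THE LARGE-q HALF OF `u = k + 1`** (`k ≥ 11`, `m ≥ k²`, `q = m + 1 + k`): `Φ(q+k, q) ≤ R̂(q, k, m)`. -/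
theorem third_untrunc_large (k m : ℕ) (hk : 11 ≤ k) (hm : k * k ≤ m) :
    phiK (m + 1 + k + k) (m + 1 + k) ≤ rhat (m + 1 + k) k m := by
  have h1 : phiK (m + 1 + k + k) (m + 1 + k) ≤ rhat (m + 1 + k) k (m + 1) := by
    have := second_untrunc_slice_every k (m + 1 + k) (by omega) (by omega)
    rwa [show m + 1 + k - k = m + 1 by omega] at this
  have h2 := rhat_le_sliceL_of_untrunc (m + 1 + k) k (m + 1) (by omega)
  have h1' : phiK (m + 1 + k + k) (m + 1 + k)
      ≤ ∑ j ∈ Finset.Ioo 0 k, ((m + 1 + k + k - (m + 1)).choose j : ℚ)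
          * ∑ a ∈ range (m + 1 + 1), ((m + 1).choose a : ℚ) / ((m + 1 + k + j + a).choose (a + j) : ℚ) :=
    h1.trans h2
  exact phiK_le_rhat_of_sliceStep k k m (by omega) h1' (step_third k m hk hm)

/-! ### §4 The theorem -/

/-- **THE THIRD UNTRUNCATED SLICE `u = k + 1` IS PAID ON EVERY CELL OF EVERY FAMILY `k ≥ 5`**:
`Φ(q+k, q) ≤ R̂(q, k, q − (k+1))` for every `q ≥ k + 1`. -/
theorem third_untrunc_slice_every (k q : ℕ) (hk : 5 ≤ k) (hq : k + 1 ≤ q) :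
    phiK (q + k) q ≤ rhat q k (q - (k + 1)) := by
  rcases Nat.lt_or_ge k 11 with h10 | h11
  · exact ((rhat_slice_iff_all_ten k (k + 1) hk (by omega)).mpr (Or.inr (by omega))) q hq
  · obtain ⟨m, rfl⟩ : ∃ m, q = m + (k + 1) := ⟨q - (k + 1), by omega⟩
    rw [show m + (k + 1) - (k + 1) = m by omega]
    rcases Nat.lt_or_ge m 3 with hm3 | hm3
    · rcases Nat.lt_or_ge m 1 with hm0 | hm1
      · have : m = 0 := by omega
        subst this
        rw [rhat_zero_eq _ _ (by omega)]
      · rcases Nat.lt_or_ge m 2 with hm1' | hm2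
        · have : m = 1 := by omega
          subst this
          exact rhatCell_one (1 + (k + 1)) k (by omega) (by omega)
        · have : m = 2 := by omega
          subst this
          exact third_untrunc_two k h11
    · rcases Nat.lt_or_ge m (k * k) with hsmall | hlarge
      · exact third_untrunc_bottom k m h11 hm3 (by omega)
      · have := third_untrunc_large k m h11 hlarge
        rwa [show m + 1 + k = m + (k + 1) by ring] at this

/-- **The slice map entry `u = k + 1`, every family `k ≥ 5`**. -/
theorem rhat_third_untrunc_slice (k : ℕ) (hk : 5 ≤ k) :
    ∀ q, k + 1 ≤ q → phiK (q + k) q ≤ rhat q k (q - (k + 1)) :=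
  fun q hq => third_untrunc_slice_every k q hk hq

/-- **THE MATROID LEVEL**: at the tight layer every member at distance `k + 1` from the top is paid (`k ≥ 5`, `q ≥ k + 1`). -/
theorem ruleQRecv_ge_phiK_third_untrunc_every {β : Type} (M : Matroid β) [M.Finite] {q k : ℕ} (hk : 5 ≤ k)
    (hq : k + 1 ≤ q) (hE : M.E.ncard = (q + k) + q) {Z : Set β} (hZ : Z ∈ cellMembers M (q + k) q)
    (hP : (flatPart M Z).ncard = q - (k + 1)) :
    phiK (q + k) q ≤ ruleQRecv M (q + k) q Z := by
  have h1 := third_untrunc_slice_every k q hk hq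
  have h2 := rhat_le_ruleQRecv M hE hZ
  rw [hP] at h2
  exact h1.trans h2

end PercRepro
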